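import Literature.NumberTheory.NumberFields.ArithmeticEquivalenceGassmannProofs
import Literature.NumberTheory.GaloisRepresentations.CyclotomicFrobenius
import HarnessLib

/-!
# Deuring's reduction, counted: degree-one primes of `E = N^H` with prescribed Frobenius in `N|E`

Topic `Summits/QuantumAdvantage/QuantumAdvantage/Theorems`, cell B2b-1 (linnik-cubic), PART A (gen 13); helper
toward the crux `DegreeOnePrimesEscape` (stmt-QuantumAdvantage-11543) — the counting lemma of step B6
(descent from the cyclic extension `N|N^{⟨σ⟩}` to the conjugacy class of `σ`) of the LMO programme.
HONEST FRAMING: the value of this file is a THEOREM (kernel-checked group theory and prime bookkeeping) —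
NOT summit progress.

Let `N/ℚ` be Galois with group `G`, `E = N^H` an intermediate field with `H = Gal(N/E)` ABELIAN, `p` a
rational prime unramified in `N` (`Q₀ ∣ p` with trivial inertia, arithmetic Frobenius `φ`), and `τ ∈ H`.

* `inertiaDegIn_mul_card_frobPrimes_eq` — `f_N(p) · #{Q ∣ p in N : τ ≡ Frob at Q} = #{g ∈ G : g φ g⁻¹ = τ}`
  (the primes above `p` are `g Q₀`, `|D(Q₀)| = f_N(p)` of them per prime, and `τ x ≡ x^p (mod g Q₀)` iff
  `g⁻¹ τ g = φ` because the inertia is trivial);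
* `card_aut_mul_card_degOneFrobPrimes_eq` — **Deuring's count**
  `|H| · #{𝔭 ∣ p in E : N𝔭 = p, Frob_{N|E}(𝔭) = τ} = #{g ∈ G : g φ g⁻¹ = τ}`:
  a prime `Q ∣ 𝔭 ∣ p` of `N` satisfies `τ x ≡ x^p (mod Q)` iff `f(𝔭|p) = 1` and `Frob_{N|E}(𝔭) = τ`
  (for `H` abelian the Frobenius of `𝔭` is a well-defined element, `eq_galFrob`), and above such a `𝔭` there
  are `|H|/f_N(p)` primes of `N` (fundamental identity for `N|E`, `e = 1`).
  [cite: LagariasMontgomeryOdlyzko1979, §3 (Deuring's reduction to the cyclic extension `L/L^{⟨σ⟩}`)]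

With `E = N^{⟨σ⟩}`, `τ = σ`: `#{g : g φ g⁻¹ = σ} = |C_G(σ)|·𝟙[Frob_p ∈ C(σ)]`, so the degree-one primes of
`E` with Frobenius `σ` count the rational primes with Frobenius class `C(σ)` with the weight `|C_G(σ)|/ord σ`.
-/

noncomputable section

open Ideal NumberField MulAction UniqueFactorizationMonoid IsDedekindDomain
open scoped Pointwise NumberField Classical

namespace Summit.QuantumAdvantage.QuantumAdvantage.Theorems.DegreeOnePrimesEscape

open Literature.NumberTheory.NumberFields Literature.NumberTheory.GaloisRepresentations

variable {N : Type} [Field N] [NumberField N] [IsGalois ℚ N]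

/-- **Counting the primes of `N` above `p` at which `τ` is the Frobenius**: for `Q₀ ∣ p` with trivial inertia
and arithmetic Frobenius `φ`, `f_N(p) · #{Q ∣ p : τ x ≡ x^p (mod Q) ∀ x} = #{g ∈ G : g φ g⁻¹ = τ}`. -/
theorem inertiaDegIn_mul_card_frobPrimes_eq (τ : N ≃ₐ[ℚ] N) {p : ℕ} (hp : p.Prime)
    (Q₀ : Ideal (𝓞 N)) [Q₀.IsMaximal] [Q₀.LiesOver (span {(p : ℤ)})]
    {φ : N ≃ₐ[ℚ] N} (hφ : IsArithFrobAt ℤ φ Q₀) (hI : Q₀.inertia (N ≃ₐ[ℚ] N) = ⊥) :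
    (span {(p : ℤ)}).inertiaDegIn (𝓞 N) *
      ∑ Q ∈ (normalizedFactors (span {(p : 𝓞 N)})).toFinset,
        (if (∀ x : 𝓞 N, τ • x - x ^ p ∈ Q) then 1 else 0) =
      Nat.card {g : N ≃ₐ[ℚ] N // g * φ * g⁻¹ = τ} := by
  classical
  haveI := Fact.mk hp
  haveI h𝔭max : (span {(p : ℤ)}).IsMaximal := Int.ideal_span_isMaximal_of_prime p
  haveI : IsGaloisGroup (N ≃ₐ[ℚ] N) ℤ (𝓞 N) := IsGaloisGroup.of_isFractionRing _ _ _ ℚ N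
  letI : Fintype (N ≃ₐ[ℚ] N) := Fintype.ofFinite _
  set c : Ideal (𝓞 N) → ℕ := fun Q => if (∀ x : 𝓞 N, τ • x - x ^ p ∈ Q) then 1 else 0 with hc
  have hφ1 : ∀ x : 𝓞 N, φ • x - x ^ p ∈ Q₀ := fun x => by
    simpa using pow_smul_sub_pow_mem_of_isArithFrobAt hφ 1 x
  have hst : φ ∈ stabilizer (N ≃ₐ[ℚ] N) Q₀ := hφ.mem_stabilizer
  -- primes above `p` = the orbit of `Q₀`
  have horbit : ∀ Q : Ideal (𝓞 N), Q ∈ (normalizedFactors (span {(p : 𝓞 N)})).toFinset ↔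
      Q ∈ orbit (N ≃ₐ[ℚ] N) Q₀ := by
    intro Q
    rw [Multiset.mem_toFinset, mem_normalizedFactors_span_iff hp,
      Algebra.IsInvariant.orbit_eq_primesOver ℤ (𝓞 N) (N ≃ₐ[ℚ] N) (span {(p : ℤ)}) Q₀]
    rfl
  have hsum := sum_smul_eq_card_stabilizer_mul_sum Q₀ c _ horbit
  -- at the prime `g Q₀` the condition reads `g⁻¹ τ g = φ`
  have hcg : ∀ g : N ≃ₐ[ℚ] N, c (g • Q₀) = if g * φ * g⁻¹ = τ then 1 else 0 := by
    intro g
    have hiff : (∀ x : 𝓞 N, τ • x - x ^ p ∈ g • Q₀) ↔ g * φ * g⁻¹ = τ := by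
      rw [forall_smul_sub_pow_mem_smul_iff, forall_smul_sub_pow_mem_iff_inv_mul_mem_inertia hst hφ1,
        hI, Subgroup.mem_bot]
      constructor
      · intro h
        have h2 : g⁻¹ * τ * g = φ := by
          calc g⁻¹ * τ * g = φ * (φ⁻¹ * (g⁻¹ * τ * g)) := by group
            _ = φ := by rw [h, mul_one]
        calc g * φ * g⁻¹ = g * (g⁻¹ * τ * g) * g⁻¹ := by rw [h2]
          _ = τ := by group
      · intro h
        rw [← h]; group
    by_cases h : g * φ * g⁻¹ = τ
    · rw [if_pos h, hc]; dsimp only; rw [if_pos (hiff.mpr h)]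
    · rw [if_neg h, hc]; dsimp only; rw [if_neg (fun h' => h (hiff.mp h'))]
  have hD : Nat.card (stabilizer (N ≃ₐ[ℚ] N) Q₀) = (span {(p : ℤ)}).inertiaDegIn (𝓞 N) := by
    rw [Ideal.card_stabilizer_eq_card_inertia_mul_finrank (span {(p : ℤ)}) Q₀, hI, Subgroup.card_bot,
      one_mul, inertiaDegIn_eq_inertiaDeg (span {(p : ℤ)}) Q₀ (N ≃ₐ[ℚ] N)]
  rw [← hD, ← hsum]
  simp_rw [hcg]
  rw [Finset.sum_boole, Nat.cast_id, Nat.card_eq_fintype_card, Fintype.card_subtype]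

/-- A prime `P` of `𝓞 E` over `pℤ` contains `p`. -/
theorem natCast_mem_of_liesOver {E : Type*} [Field E] [NumberField E] {p : ℕ} (P : Ideal (𝓞 E))
    [h : P.LiesOver (span {(p : ℤ)})] : (p : 𝓞 E) ∈ P := by
  have h1 : ((p : ℤ) : 𝓞 E) ∈ P := by
    have : (p : ℤ) ∈ P.under ℤ := by rw [← h.over]; exact Ideal.mem_span_singleton_self _
    rw [Ideal.under_def, Ideal.mem_comap] at this
    simpa using this
  simpa using h1

/-- A nonzero prime `v` of `𝓞 E` containing `p` lies over `pℤ`. -/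
theorem liesOver_of_natCast_mem {E : Type*} [Field E] [NumberField E] {p : ℕ} (hp : p.Prime)
    (v : HeightOneSpectrum (𝓞 E)) (hpv : (p : 𝓞 E) ∈ v.asIdeal) : v.asIdeal.LiesOver (span {(p : ℤ)}) := by
  haveI := Fact.mk hp
  haveI h𝔭max : (span {(p : ℤ)}).IsMaximal := Int.ideal_span_isMaximal_of_prime p
  refine ⟨Ideal.IsMaximal.eq_of_le h𝔭max (Ideal.IsPrime.under ℤ v.asIdeal).ne_top ?_⟩
  rw [Ideal.span_le, Set.singleton_subset_iff, SetLike.mem_coe, Ideal.under_def, Ideal.mem_comap, map_natCast]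
  exact hpv

/-- **Deuring's count.**  `N/ℚ` Galois with group `G`, `E` an intermediate field with `Gal(N/E)` abelian,
`p` a prime with `Q₀ ∣ p` of trivial inertia and arithmetic Frobenius `φ`, every prime of `E` above `p`
unramified in `N`, and `τ ∈ Gal(N/E)`.  Then
`|Gal(N/E)| · #{𝔭 ∣ p in E : N𝔭 = p, Frob_{N|E}(𝔭) = τ} = #{g ∈ G : g φ g⁻¹ = τ}`.
[cite: LagariasMontgomeryOdlyzko1979, §3] -/
theorem card_aut_mul_card_degOneFrobPrimes_eq (E : IntermediateField ℚ N)
    (hcomm : ∀ a b : N ≃ₐ[E] N, Commute a b) {p : ℕ} (hp : p.Prime)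
    (Q₀ : Ideal (𝓞 N)) [Q₀.IsMaximal] [Q₀.LiesOver (span {(p : ℤ)})]
    {φ : N ≃ₐ[ℚ] N} (hφ : IsArithFrobAt ℤ φ Q₀) (hI : Q₀.inertia (N ≃ₐ[ℚ] N) = ⊥)
    (hunr : ∀ v : HeightOneSpectrum (𝓞 E), (p : 𝓞 E) ∈ v.asIdeal → Algebra.IsUnramifiedIn (𝓞 N) v.asIdeal)
    {τ : N ≃ₐ[ℚ] N} (hτ : τ ∈ E.fixingSubgroup) :
    Nat.card (N ≃ₐ[E] N) *
      Nat.card {v : HeightOneSpectrum (𝓞 E) // (p : 𝓞 E) ∈ v.asIdeal ∧ absNorm v.asIdeal = p ∧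
        galFrob E N v = IntermediateField.fixingSubgroupEquiv E ⟨τ, hτ⟩} =
      Nat.card {g : N ≃ₐ[ℚ] N // g * φ * g⁻¹ = τ} := by
  classical
  haveI := Fact.mk hp
  haveI h𝔭max : (span {(p : ℤ)}).IsMaximal := Int.ideal_span_isMaximal_of_prime p
  have hp𝔭 : (span {(p : ℤ)}) ≠ ⊥ := by
    rw [Ne, span_singleton_eq_bot]
    exact_mod_cast hp.ne_zero
  haveI : IsGaloisGroup (N ≃ₐ[ℚ] N) ℤ (𝓞 N) := IsGaloisGroup.of_isFractionRing _ _ _ ℚ N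
  haveI : IsGaloisGroup (N ≃ₐ[E] N) (𝓞 E) (𝓞 N) := IsGaloisGroup.of_isFractionRing _ _ _ E N
  set τ' : N ≃ₐ[E] N := IntermediateField.fixingSubgroupEquiv E ⟨τ, hτ⟩ with hτ'
  have hτ'smul : ∀ x : 𝓞 N, τ' • x = τ • x := fun x => fixingSubgroupEquiv_smul E ⟨τ, hτ⟩ x
  rw [← inertiaDegIn_mul_card_frobPrimes_eq τ hp Q₀ hφ hI]
  set SN := (normalizedFactors (span {(p : 𝓞 N)})).toFinset with hSN
  set SE := (normalizedFactors (span {(p : 𝓞 E)})).toFinset with hSE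
  have hmemN : ∀ Q : Ideal (𝓞 N), Q ∈ SN ↔ Q.IsPrime ∧ Q.LiesOver (span {(p : ℤ)}) := fun Q => by
    rw [hSN, Multiset.mem_toFinset]
    exact mem_normalizedFactors_span_iff hp
  have hmemE : ∀ P : Ideal (𝓞 E), P ∈ SE ↔ P.IsPrime ∧ P.LiesOver (span {(p : ℤ)}) := fun P => by
    rw [hSE, Multiset.mem_toFinset]
    exact mem_normalizedFactors_span_iff hp
  -- the condition on a prime `P` of `E`
  set condP : Ideal (𝓞 E) → Prop := fun P => ∃ v : HeightOneSpectrum (𝓞 E), v.asIdeal = P ∧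
    absNorm P = p ∧ galFrob E N v = τ' with hcondP
  -- the map `Q ↦ Q ∩ 𝓞 E` sends `SN` to `SE`
  have hmaps : ∀ Q ∈ SN, Q.under (𝓞 E) ∈ SE := by
    intro Q hQ
    obtain ⟨hQp, hQl⟩ := (hmemN Q).1 hQ
    refine (hmemE _).2 ⟨IsPrime.under (𝓞 E) Q, ⟨?_⟩⟩
    rw [under_under]
    exact over_def Q _
  rw [← Finset.sum_fiberwise_of_maps_to hmaps, Finset.mul_sum]
  -- fibrewise evaluation
  have hfibre : ∀ P ∈ SE, (span {(p : ℤ)}).inertiaDegIn (𝓞 N) *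
      (∑ Q ∈ SN.filter (fun Q => Q.under (𝓞 E) = P), if (∀ x : 𝓞 N, τ • x - x ^ p ∈ Q) then 1 else 0) =
      if condP P then Nat.card (N ≃ₐ[E] N) else 0 := by
    intro P hP
    obtain ⟨hPp, hPl⟩ := (hmemE P).1 hP
    have hP0 : P ≠ ⊥ := ne_bot_of_liesOver_of_ne_bot hp𝔭 P
    haveI hPmax : P.IsMaximal := hPp.isMaximal hP0
    haveI := hPl
    set vP : HeightOneSpectrum (𝓞 E) := ⟨P, hPp, hP0⟩ with hvP
    have hpP : (p : 𝓞 E) ∈ P := natCast_mem_of_liesOver P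
    have hunrP : Algebra.IsUnramifiedIn (𝓞 N) vP.asIdeal := hunr vP hpP
    have hcardP : Nat.card (𝓞 E ⧸ P) = absNorm P := by
      rw [← Submodule.cardQuot_apply, ← Ideal.absNorm_apply]
    -- a prime of `N` above `P`
    obtain ⟨Q₁, hQ₁max, hQ₁over⟩ := Ideal.exists_maximal_ideal_liesOver_of_isIntegral (S := 𝓞 N) P
    haveI := hQ₁max
    haveI := hQ₁over
    haveI : Q₁.LiesOver (span {(p : ℤ)}) := LiesOver.trans Q₁ P _
    have hQ₁mem : Q₁ ∈ vP.asIdeal.primesOver (𝓞 N) := ⟨hQ₁max.isPrime, hQ₁over⟩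
    -- the fibre of `Q ↦ Q ∩ 𝓞 E` above `P` is `primesOver P (𝓞 N)`
    have hfib : ∀ Q : Ideal (𝓞 N), Q ∈ SN.filter (fun Q => Q.under (𝓞 E) = P) ↔
        Q ∈ P.primesOver (𝓞 N) := by
      intro Q
      rw [Finset.mem_filter, hmemN]
      constructor
      · rintro ⟨⟨hQp, -⟩, hQu⟩
        exact ⟨hQp, ⟨hQu.symm⟩⟩
      · rintro ⟨hQp, hQl⟩
        haveI := hQp
        haveI := hQl
        exact ⟨⟨hQp, LiesOver.trans Q P _⟩, hQl.over.symm⟩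
    -- on the fibre the summand is constant `= 𝟙[condP P]`
    have hconst : ∀ Q ∈ SN.filter (fun Q => Q.under (𝓞 E) = P),
        (if (∀ x : 𝓞 N, τ • x - x ^ p ∈ Q) then 1 else 0) = if condP P then 1 else 0 := by
      intro Q hQ
      obtain ⟨hQp, hQl⟩ := (hfib Q).1 hQ
      haveI := hQp
      haveI := hQl
      haveI : Q.LiesOver (span {(p : ℤ)}) := LiesOver.trans Q P _
      have hQ0 : Q ≠ ⊥ := ne_bot_of_liesOver_of_ne_bot hP0 Q
      haveI : Q.IsMaximal := hQp.isMaximal hQ0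
      have hQmem : Q ∈ vP.asIdeal.primesOver (𝓞 N) := ⟨hQp, hQl⟩
      have hu : Q.under (𝓞 E) = P := hQl.over.symm
      have hiff : (∀ x : 𝓞 N, τ • x - x ^ p ∈ Q) ↔ condP P := by
        constructor
        · intro hcong
          -- `f(P|p) = 1`
          have hcount := card_fixingSubgroup_frobPow E hp Q 1
          rw [hu, pow_one] at hcount
          have hne : Nat.card {σ : N ≃ₐ[ℚ] N // σ ∈ E.fixingSubgroup ∧ ∀ x : 𝓞 N, σ • x - x ^ p ∈ Q} ≠ 0 := by
            haveI : Nonempty {σ : N ≃ₐ[ℚ] N // σ ∈ E.fixingSubgroup ∧ ∀ x : 𝓞 N, σ • x - x ^ p ∈ Q} :=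
              ⟨⟨τ, hτ, hcong⟩⟩
            exact Nat.card_pos.ne'
          have hf1 : P.inertiaDeg ℤ = 1 := by
            by_contra hne1
            apply hne
            rw [hcount, if_neg (fun h => hne1 (Nat.dvd_one.mp h))]
          have hNP : absNorm P = p := by
            rw [← Ideal.pow_inertiaDeg p P, hf1, pow_one]
          -- `τ'` is a Frobenius at `Q` over `𝓞 E`
          have hfrob : IsArithFrobAt (𝓞 E) τ' Q := by
            intro x
            rw [MulSemiringAction.toAlgHom_apply, hu, hcardP, hNP, hτ'smul]
            exact hcong x
          exact ⟨vP, rfl, hNP, (eq_galFrob hcomm hunrP hQmem hfrob).symm⟩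
        · rintro ⟨v, hv, hNP, hfrobv⟩
          have hvv : v = vP := HeightOneSpectrum.ext hv
          subst hvv
          haveI : Finite (𝓞 N ⧸ Q) := Ideal.finiteQuotientOfFreeOfNeBot Q hQ0
          obtain ⟨ψ, hψ⟩ := IsArithFrobAt.exists_of_isInvariant (𝓞 E) (N ≃ₐ[E] N) Q
          have hψτ : ψ = τ' := by rw [eq_galFrob hcomm hunrP hQmem hψ, hfrobv]
          intro x
          have h1 := hψ x
          rw [MulSemiringAction.toAlgHom_apply, hu, hcardP, hNP, hψτ, hτ'smul] at h1
          exact h1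
      by_cases h : condP P
      · rw [if_pos h, if_pos (hiff.mpr h)]
      · rw [if_neg h, if_neg (fun h' => h (hiff.mp h'))]
    rw [Finset.sum_congr rfl hconst, Finset.sum_const, smul_eq_mul]
    -- the number of primes of `N` above `P`
    have hcardfib : (SN.filter (fun Q => Q.under (𝓞 E) = P)).card = (P.primesOver (𝓞 N)).ncard := by
      rw [← Set.ncard_coe_finset]
      congr 1
      ext Q
      rw [Finset.mem_coe]
      exact hfib Q
    rw [hcardfib]
    split_ifs with hcond
    · -- `f_N(p) · #primesOver P = |Gal(N/E)|` since `f(P|p) = 1`, `e(P) = 1`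
      obtain ⟨v, hv, hNP, -⟩ := hcond
      have hf1 : P.inertiaDeg ℤ = 1 := by
        have h := Ideal.pow_inertiaDeg p P
        rw [hNP] at h
        exact Nat.pow_right_injective hp.two_le (show p ^ P.inertiaDeg ℤ = p ^ 1 by rw [h, pow_one])
      have hfund := Ideal.ncard_primesOver_mul_ramificationIdxIn_mul_inertiaDegIn P (𝓞 N) (N ≃ₐ[E] N)
      have htower : (span {(p : ℤ)}).inertiaDegIn (𝓞 N) = P.inertiaDeg ℤ * P.inertiaDegIn (𝓞 N) := by
        rw [inertiaDegIn_eq_inertiaDeg (span {(p : ℤ)}) Q₁ (N ≃ₐ[ℚ] N),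
          inertiaDegIn_eq_inertiaDeg P Q₁ (N ≃ₐ[E] N), inertiaDeg_tower P Q₁]
      have he1 : P.ramificationIdxIn (𝓞 N) = 1 := by
        rw [← Ideal.card_inertia_eq_ramificationIdxIn (G := N ≃ₐ[E] N) P Q₁,
          inertia_eq_bot_of_isUnramifiedIn hunrP hQ₁mem, Subgroup.card_bot]
      rw [← hfund, htower, hf1, he1]; ring
    · simp
  -- `#{v : p ∈ v, N v = p, Frob v = τ'} = #{P ∈ SE : condP P}`
  have hcount : Nat.card {v : HeightOneSpectrum (𝓞 E) // (p : 𝓞 E) ∈ v.asIdeal ∧ absNorm v.asIdeal = p ∧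
      galFrob E N v = τ'} = (SE.filter condP).card := by
    rw [← Nat.card_eq_finsetCard]
    refine Nat.card_eq_of_bijective
      (fun v => ⟨v.1.asIdeal, Finset.mem_filter.mpr ⟨(hmemE _).2 ⟨v.1.isPrime, liesOver_of_natCast_mem hp v.1 v.2.1⟩,
        ⟨v.1, rfl, v.2.2.1, v.2.2.2⟩⟩⟩) ⟨?_, ?_⟩
    · intro v w hvw
      apply Subtype.ext
      apply HeightOneSpectrum.ext
      exact congrArg (fun P : {P : Ideal (𝓞 E) // P ∈ SE.filter condP} => (P.1 : Ideal (𝓞 E))) hvw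
    · rintro ⟨P, hP⟩
      obtain ⟨hPSE, ⟨v, hv, hNP, hfrobv⟩⟩ := Finset.mem_filter.mp hP
      haveI := ((hmemE P).1 hPSE).2
      have hpv : (p : 𝓞 E) ∈ v.asIdeal := by rw [hv]; exact natCast_mem_of_liesOver P
      refine ⟨⟨v, hpv, by rw [hv]; exact hNP, hfrobv⟩, ?_⟩
      exact Subtype.ext hv
  rw [Finset.sum_congr rfl hfibre, Finset.sum_ite, Finset.sum_const_zero, add_zero, Finset.sum_const,
    smul_eq_mul, hcount, mul_comm]

end Summit.QuantumAdvantage.QuantumAdvantage.Theorems.DegreeOnePrimesEscape
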